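import Summits.CriticalPhenomena.PercolationContinuityZ3.Theorems.PercNearOneGluingNoHeavyQuantIndepBlobGapCalculus
import HarnessLib

/-!
# QUANT lane R8, T-DIB: the TWO-POINT (supporting-line) REDUCTION of the heavy side — `P(N ≥ j+1) = E[TL_S(j+1−N_H)]`
# is at least the value at `m_H = E[N_H]` of any affine minorant of `n ↦ TL_S(j+1−n)` on `[0, A_H]`

builds on p205010 (kernel theorem, internal audit signed; external expert review pending)

Support file (`--supports stmt-CriticalPhenomena-4575`), QUANT lane seat prim-quant-p1 (gen 12); memo
`run/shared/lean/prim/quant/P1-SURPLUS.md` §23.  Theorems only; no definitions, no sorries, standard axioms.  Vocabulary of lead g16's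
gap calculus (`…QuantIndepBlobGapCalculus`): restricted product-Bernoulli law of a finset `U` of blobs with restricted tail
`TL_U(t) = Σ_{s ⊆ U} w_U(s)·𝟙[t ≤ Σ_{k∈s} a k]`, `tailU_insert`, `tailU_univ`.

THE REDUCTION.  Split the blobs into an arbitrary finset `S` (in the application: the sub-floor blobs, possibly with companions) and
its complement `H = Sᶜ` (the heavy blobs).  Conditioning on the blobs of `H`,
`P(N ≥ j+1) = Σ_{h ⊆ H} w_H(h)·TL_S(j + 1 − a(h)) = E[f(N_H)]`, `f(n) := TL_S(j+1−n)` (truncated subtraction: `f(n) = 1` for `n ≥ j+1`),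
`N_H` the open mass of `H`, `E[N_H] = m_H = Σ_{k∈H} a k·p k`.  Hence for EVERY affine function `α + β·n` lying below `f` on the integers
`0 ≤ n ≤ A_H = Σ_{k ∈ H} a k` one has `P(N ≥ j+1) ≥ α + β·m_H` (Jensen for affine functions is an identity; no sign condition on `β`, no
floor condition on the gates of `H`).  Equivalently (finite convex duality in one variable, `exists_line_of_chords`): `P(N ≥ j+1)` is at
least the value at `m_H` of the greatest convex minorant of `f` on `{0, …, A_H}`, i.e. it suffices that EVERY CHORD of `f` through
`m_H` lies above the floor: `x·(n₂ − n₁) ≤ (n₂ − m_H)·f(n₁) + (m_H − n₁)·f(n₂)` for all integers `n₁ < m_H < n₂ ≤ A_H` (and `x ≤ f(m_H)` if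
`m_H` is an integer).  The chord through `(n₁, n₂)` is the row for the system in which the whole heavy side is replaced by a sure mass `n₁`
plus ONE pseudo-blob of size `n₂ − n₁` and gate `(m_H − n₁)/(n₂ − n₁)` — so the heavy side of Conjecture DIB\* (`…QuantDIBStar`) is
reduced to at most one blob.

* `Quant.IndepBlob.tailU_union_line` — the inductive form: an affine minorant of `n ↦ TL_S(t − n)` on `n ≤ N₀` gives
  `α + β·(n + m_H) ≤ TL_{S ∪ H}(t − n)` for every finset `H` disjoint from `S` (gates of `H` in `[0,1]`) and `n + A_H ≤ N₀`.
* `Quant.IndepBlob.tail_ge_of_heavyLine` — **the supporting-line certificate**: `α + β n ≤ TL_S(j+1−n)` for `n ≤ Σ_{k∉S} a k` and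
  `x ≤ α + β·Σ_{k∉S} a k·p k` ⟹ `x ≤ P(N ≥ j+1)`.
* `Quant.IndepBlob.exists_line_of_chords` — one-variable convex duality on a finite set: if every chord of `f` through `m ∈ [0, A]`
  lies above `x` (and `x ≤ f(m)` when `m` is an integer) then some affine minorant of `f` on `{0, …, A}` has value `≥ x` at `m`.
* `Quant.IndepBlob.tail_ge_of_heavyChords` — **the two-point (chord) certificate**: `x ≤ P(N ≥ j+1)` as soon as every chord of
  `n ↦ TL_S(j+1−n)` through `m_H` over `[0, Σ_{k∉S} a k]` lies above `x`.

NUMERICS (this seat, `run/shared/lean/prim/quant/prim-quant-p1-g12/evidence/num/e7*.py`, `e8_chords.py`, `e11_largej.py`): with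
`S =` the sub-floor blobs, the chord certificate holds on EVERY sampled instance of the open corner of DIB\* (`x > 1/2`, heavy total
`≤ 2j`, discounted credit `> 2j`) in which the least reliable light blob is not mergeable (p1 g11's graded-merge row covers the rest):
`≈ 1.3·10⁵` random instances with 1–5 light blobs, `j ≤ 300`, plus `1 900` adversarially optimised integer cells — 0 failures, minimal
margin `0.22·(1 − x)` = the true extremal margin of DIB\* (three tied blobs at `x ↓ 2/3`, where the chord bound is exact).  The binding
chord is `(0, A_H)` (one pseudo-blob of size `A_H`, gate `m_H/A_H ≥ x`) in 88 % of the instances.  Nearest prior art searched (corpus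
fts + vec, galaxy `Jensen|two-point distribution|extremal moment`): the two-point extremality of a one-moment constraint is textbook
(Karlin–Studden type); its use as a heavy-side reduction for the gluing rows is [this work].  The rows served:
[cite: KozmaNitzan2024, Conjecture 3 (p. 15)].
-/

namespace Summit.CriticalPhenomena.PercolationContinuityZ3.Theorems

namespace Quant

namespace IndepBlob

open Finset

variable {κ : Type*} [DecidableEq κ]

/-! ### 1. Affine minorants pass through the heavy side -/

/-- **The inductive form of the supporting-line reduction.**  Let `S` be a finset of blobs, `t` a level and `α + β·n` an affine
function with `α + β·n ≤ TL_S(t − n)` for all `n ≤ N₀` (truncated subtraction).  Then for every finset `H` disjoint from `S` whose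
gates lie in `[0,1]` and every `n` with `n + Σ_{k∈H} a k ≤ N₀`:
`α + β·(n + Σ_{k∈H} a k·p k) ≤ TL_{S ∪ H}(t − n)` — conditioning on one blob of `H` at a time (`tailU_insert`), the affine function
passes through the average exactly. [this work] -/
theorem tailU_union_line (p : κ → ℝ) (a : κ → ℕ) (S : Finset κ) (t N₀ : ℕ) (α β : ℝ)
    (hline : ∀ n : ℕ, n ≤ N₀ → α + β * n ≤
      ∑ s ∈ S.powerset, (∏ i ∈ S, (if i ∈ s then p i else 1 - p i)) * (if t - n ≤ ∑ i ∈ s, a i then (1 : ℝ) else 0))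
    (H : Finset κ) (hdisj : Disjoint S H) (hp0 : ∀ k ∈ H, 0 ≤ p k) (hp1 : ∀ k ∈ H, p k ≤ 1) :
    ∀ n : ℕ, n + ∑ k ∈ H, a k ≤ N₀ → α + β * (n + ∑ k ∈ H, (a k : ℝ) * p k) ≤
      ∑ s ∈ (S ∪ H).powerset, (∏ i ∈ S ∪ H, (if i ∈ s then p i else 1 - p i)) *
        (if t - n ≤ ∑ i ∈ s, a i then (1 : ℝ) else 0) := by
  induction H using Finset.induction_on with
  | empty =>
    intro n hn
    simp only [Finset.union_empty, Finset.sum_empty, add_zero] at hn ⊢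
    exact hline n hn
  | @insert k H hkH ih =>
    intro n hn
    have hdisj' : Disjoint S H := Finset.disjoint_of_subset_right (Finset.subset_insert k H) hdisj
    have hp0' : ∀ i ∈ H, 0 ≤ p i := fun i hi => hp0 i (Finset.mem_insert_of_mem hi)
    have hp1' : ∀ i ∈ H, p i ≤ 1 := fun i hi => hp1 i (Finset.mem_insert_of_mem hi)
    have ih' := ih hdisj' hp0' hp1'
    have hkS : k ∉ S := fun h => Finset.disjoint_left.mp hdisj h (Finset.mem_insert_self k H)
    have hkSH : k ∉ S ∪ H := by
      rw [Finset.mem_union]; exact fun h => h.elim hkS hkH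
    have hset : S ∪ insert k H = insert k (S ∪ H) := by
      ext i; simp only [Finset.mem_union, Finset.mem_insert]; tauto
    rw [hset, tailU_insert p a (S ∪ H) k hkSH (t - n)]
    rw [Finset.sum_insert hkH] at hn
    rw [Finset.sum_insert hkH]
    have hsub : t - n - a k = t - (n + a k) := by omega
    rw [hsub]
    have h1 := ih' (n + a k) (by omega)
    have h2 := ih' n (by omega)
    have hq0 : 0 ≤ p k := hp0 k (Finset.mem_insert_self k H)
    have hq1 : 0 ≤ 1 - p k := by linarith [hp1 k (Finset.mem_insert_self k H)]
    have hc1 := mul_le_mul_of_nonneg_left h1 hq0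
    have hc2 := mul_le_mul_of_nonneg_left h2 hq1
    have hid : α + β * (↑n + (↑(a k) * p k + ∑ k ∈ H, (a k : ℝ) * p k)) =
        p k * (α + β * (((n + a k : ℕ) : ℝ) + ∑ k ∈ H, (a k : ℝ) * p k)) +
          (1 - p k) * (α + β * (↑n + ∑ k ∈ H, (a k : ℝ) * p k)) := by
      push_cast; ring
    rw [hid]
    linarith

/-- **THE SUPPORTING-LINE CERTIFICATE.**  Gates in `[0,1]`; `S` any finset of blobs (the "light side"); `A' = Σ_{k ∉ S} a k` and
`m' = Σ_{k ∉ S} a k·p k` the total size and the mean open mass OFF `S`.  If an affine function lies below `n ↦ TL_S(j + 1 − n)` on the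
integers `0 ≤ n ≤ A'` and has value `≥ x` at `m'`, then `x ≤ P(N ≥ j+1)` for the whole system:
`P(N ≥ j+1) = E[TL_S(j+1−N_{Sᶜ})] ≥ E[α + β N_{Sᶜ}] = α + β·m' ≥ x`. [this work] -/
theorem tail_ge_of_heavyLine [Fintype κ] (p : κ → ℝ) (a : κ → ℕ) (hp0 : ∀ i, 0 ≤ p i) (hp1 : ∀ i, p i ≤ 1)
    (S : Finset κ) (j : ℕ) (x α β : ℝ)
    (hline : ∀ n : ℕ, n ≤ ∑ k ∈ Sᶜ, a k → α + β * n ≤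
      ∑ s ∈ S.powerset, (∏ i ∈ S, (if i ∈ s then p i else 1 - p i)) * (if j + 1 - n ≤ ∑ i ∈ s, a i then (1 : ℝ) else 0))
    (hm : x ≤ α + β * ∑ k ∈ Sᶜ, (a k : ℝ) * p k) :
    x ≤ ∑ s : Finset κ, (∏ i, (if i ∈ s then p i else 1 - p i)) * (if j + 1 ≤ ∑ i ∈ s, a i then (1 : ℝ) else 0) := by
  have h := tailU_union_line p a S (j + 1) (∑ k ∈ Sᶜ, a k) α β hline Sᶜ disjoint_compl_right
    (fun k _ => hp0 k) (fun k _ => hp1 k) 0 (by simp)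
  simp only [Nat.cast_zero, zero_add, Nat.sub_zero] at h
  rw [Finset.union_compl, tailU_univ] at h
  exact le_trans hm h

/-! ### 2. Chords through the mean: one-variable convex duality on a finite set -/

/-- **Chords above the floor give a supporting line.**  `f : ℕ → ℝ`, `m` real (in the application `0 ≤ m ≤ A`).  If `x ≤ f(n)` whenever the integer `n ≤ A` equals
`m`, and every chord of `f` through `m` lies above `x` — `x·(n₂ − n₁) ≤ (n₂ − m)·f(n₁) + (m − n₁)·f(n₂)` for all integers
`n₁ < m < n₂ ≤ A` — then there is an affine function `α + β·n ≤ f(n)` on `0 ≤ n ≤ A` with `x ≤ α + β·m`.  (The line through `(m, x)`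
with slope `β = min_{n₂ > m} (f(n₂) − x)/(n₂ − m)`; the chord condition says every `n₁ < m` lies above it.) [this work] -/
theorem exists_line_of_chords (f : ℕ → ℝ) (A : ℕ) (m x : ℝ)
    (hint : ∀ n : ℕ, n ≤ A → (n : ℝ) = m → x ≤ f n)
    (hchord : ∀ n₁ n₂ : ℕ, (n₁ : ℝ) < m → m < (n₂ : ℝ) → n₂ ≤ A →
      x * ((n₂ : ℝ) - n₁) ≤ ((n₂ : ℝ) - m) * f n₁ + (m - n₁) * f n₂) :
    ∃ α β : ℝ, (∀ n : ℕ, n ≤ A → α + β * n ≤ f n) ∧ x ≤ α + β * m := by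
  classical
  -- the integers above `m` in `[0, A]`
  set Shi : Finset ℕ := (Finset.range (A + 1)).filter (fun n => m < (n : ℝ)) with hShi
  by_cases hhi : Shi.Nonempty
  · -- slope = the least upper slope
    obtain ⟨n₂, hn₂mem, hn₂min⟩ := Finset.exists_min_image Shi (fun n => (f n - x) / ((n : ℝ) - m)) hhi
    have hn₂' : n₂ ≤ A ∧ m < (n₂ : ℝ) := by
      rw [hShi, Finset.mem_filter, Finset.mem_range] at hn₂mem; exact ⟨by omega, hn₂mem.2⟩
    set β : ℝ := (f n₂ - x) / ((n₂ : ℝ) - m) with hβ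
    refine ⟨x - β * m, β, fun n hn => ?_, by linarith⟩
    have hd₂ : 0 < (n₂ : ℝ) - m := by linarith [hn₂'.2]
    rcases lt_trichotomy (n : ℝ) m with hlt | heq | hgt
    · -- `n < m`: the chord `(n, n₂)`
      have hc := hchord n n₂ hlt hn₂'.2 hn₂'.1
      have hβeq : β * ((n₂ : ℝ) - m) = f n₂ - x := by rw [hβ]; field_simp
      -- `x (n₂ − n) ≤ (n₂ − m) f n + (m − n) f n₂` and `f n₂ = x + β (n₂ − m)`
      have hd₁ : 0 < m - (n : ℝ) := by linarith
      nlinarith [hc, hβeq, hd₁, hd₂]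
    · have := hint n hn heq
      rw [heq]
      linarith
    · -- `n > m`: the slope to `n` is at least `β`
      have hnmem : n ∈ Shi := by
        rw [hShi, Finset.mem_filter, Finset.mem_range]; exact ⟨by omega, hgt⟩
      have hle := hn₂min n hnmem
      have hdn : 0 < (n : ℝ) - m := by linarith
      have h1 : β ≤ (f n - x) / ((n : ℝ) - m) := hle
      rw [le_div_iff₀ hdn] at h1
      linarith
  · -- no integer above `m` in range: `m = A`; use the largest lower slope (or slope 0)
    set Slo : Finset ℕ := (Finset.range (A + 1)).filter (fun n => (n : ℝ) < m) with hSlo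
    by_cases hlo : Slo.Nonempty
    · obtain ⟨n₁, hn₁mem, hn₁max⟩ := Finset.exists_max_image Slo (fun n => (x - f n) / (m - (n : ℝ))) hlo
      have hn₁' : n₁ ≤ A ∧ (n₁ : ℝ) < m := by
        rw [hSlo, Finset.mem_filter, Finset.mem_range] at hn₁mem; exact ⟨by omega, hn₁mem.2⟩
      set β : ℝ := (x - f n₁) / (m - (n₁ : ℝ)) with hβ
      refine ⟨x - β * m, β, fun n hn => ?_, by linarith⟩
      rcases lt_trichotomy (n : ℝ) m with hlt | heq | hgt
      · have hnmem : n ∈ Slo := by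
          rw [hSlo, Finset.mem_filter, Finset.mem_range]; exact ⟨by omega, hlt⟩
        have hle := hn₁max n hnmem
        have hdn : 0 < m - (n : ℝ) := by linarith
        have h1 : (x - f n) / (m - (n : ℝ)) ≤ β := hle
        rw [div_le_iff₀ hdn] at h1
        linarith
      · have := hint n hn heq
        rw [heq]
        linarith
      · exact absurd ⟨n, by rw [hShi, Finset.mem_filter, Finset.mem_range]; exact ⟨by omega, hgt⟩⟩ hhi
    · -- neither below nor above: every integer `n ≤ A` equals `m`
      refine ⟨x, 0, fun n hn => ?_, by linarith⟩
      rcases lt_trichotomy (n : ℝ) m with hlt | heq | hgt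
      · exact absurd ⟨n, by rw [hSlo, Finset.mem_filter, Finset.mem_range]; exact ⟨by omega, hlt⟩⟩ hlo
      · have := hint n hn heq
        linarith
      · exact absurd ⟨n, by rw [hShi, Finset.mem_filter, Finset.mem_range]; exact ⟨by omega, hgt⟩⟩ hhi

/-- **THE TWO-POINT (CHORD) CERTIFICATE.**  Gates in `[0,1]`; `S` any finset of blobs; `A' = Σ_{k∉S} a k`, `m' = Σ_{k∉S} a k·p k`
(so `0 ≤ m' ≤ A'`), `f(n) = TL_S(j + 1 − n)`.  If `x ≤ f(n)` for the integer `n = m'` (when `m'` is an integer) and every chord of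
`f` through `m'` over `[0, A']` lies above `x`:
`x·(n₂ − n₁) ≤ (n₂ − m')·TL_S(j+1−n₁) + (m' − n₁)·TL_S(j+1−n₂)` for all integers `n₁ < m' < n₂ ≤ A'`,
then `x ≤ P(N ≥ j+1)`.  The chord `(n₁, n₂)` is the row for the system whose blobs off `S` are replaced by a sure mass `n₁` and ONE
blob of size `n₂ − n₁` and gate `(m' − n₁)/(n₂ − n₁)`: the heavy side of DIB\* reduces to a single pseudo-blob. [this work] -/
theorem tail_ge_of_heavyChords [Fintype κ] (p : κ → ℝ) (a : κ → ℕ) (hp0 : ∀ i, 0 ≤ p i) (hp1 : ∀ i, p i ≤ 1)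
    (S : Finset κ) (j : ℕ) (x : ℝ)
    (hint : ∀ n : ℕ, n ≤ ∑ k ∈ Sᶜ, a k → (n : ℝ) = ∑ k ∈ Sᶜ, (a k : ℝ) * p k →
      x ≤ ∑ s ∈ S.powerset, (∏ i ∈ S, (if i ∈ s then p i else 1 - p i)) * (if j + 1 - n ≤ ∑ i ∈ s, a i then (1 : ℝ) else 0))
    (hchord : ∀ n₁ n₂ : ℕ, (n₁ : ℝ) < ∑ k ∈ Sᶜ, (a k : ℝ) * p k → (∑ k ∈ Sᶜ, (a k : ℝ) * p k) < (n₂ : ℝ) → n₂ ≤ ∑ k ∈ Sᶜ, a k →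
      x * ((n₂ : ℝ) - n₁) ≤
        ((n₂ : ℝ) - ∑ k ∈ Sᶜ, (a k : ℝ) * p k) *
            (∑ s ∈ S.powerset, (∏ i ∈ S, (if i ∈ s then p i else 1 - p i)) *
              (if j + 1 - n₁ ≤ ∑ i ∈ s, a i then (1 : ℝ) else 0)) +
          ((∑ k ∈ Sᶜ, (a k : ℝ) * p k) - n₁) *
            (∑ s ∈ S.powerset, (∏ i ∈ S, (if i ∈ s then p i else 1 - p i)) *
              (if j + 1 - n₂ ≤ ∑ i ∈ s, a i then (1 : ℝ) else 0))) :
    x ≤ ∑ s : Finset κ, (∏ i, (if i ∈ s then p i else 1 - p i)) * (if j + 1 ≤ ∑ i ∈ s, a i then (1 : ℝ) else 0) := by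
  set m : ℝ := ∑ k ∈ Sᶜ, (a k : ℝ) * p k with hm
  set A : ℕ := ∑ k ∈ Sᶜ, a k with hA
  obtain ⟨α, β, hline, hxm⟩ := exists_line_of_chords
    (fun n => ∑ s ∈ S.powerset, (∏ i ∈ S, (if i ∈ s then p i else 1 - p i)) *
      (if j + 1 - n ≤ ∑ i ∈ s, a i then (1 : ℝ) else 0)) A m x hint hchord
  exact tail_ge_of_heavyLine p a hp0 hp1 S j x α β hline hxm

end IndepBlob

end Quant

end Summit.CriticalPhenomena.PercolationContinuityZ3.Theorems
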